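import Literature.NumberTheory.GaloisCohomology.Howard2004.DVRSettingEngineAssembly
import Literature.NumberTheory.GaloisCohomology.Howard2004.DVRSettingEngineLiftKappaProofs
import Literature.NumberTheory.GaloisCohomology.Howard2004.DVRSettingEngineKSProofs
import Literature.NumberTheory.GaloisCohomology.Howard2004.Thm161OfFullTowersProofs
import HarnessLib

/-!
# Howard 2004, Thm. 1.6.1 on FULL settings from the engine: the landed bricks `hlift` (Lemma 1.6.3) and `hKS`
# (the Kolyvagin relations) plugged into `conclusion_of_engineInputs` (theorems only)

B. Howard, *The Heegner point Kolyvagin system*, Compositio Math. **140** (2004) (arXiv:1202.6340), Thm. 1.6.1 and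
Lemma 1.6.4 (arXiv Thm. 2.6.1 / Lemma 2.6.4, p. 11 L23 – p. 12 L33).  `DVRSettingEngineAssembly.conclusion_of_engineInputs`
gives the conclusion record of Thm. 1.6.1 for a `DVRSetting` with H.0–H.5 from the levelwise structure and SEVEN engine
inputs.  Two of them are in the tree in (almost) the instantiated shape:

* `hlift` — `DVRSettingEngineLiftKappaProofs.kappaSel_mem_stub_of_redSel_eq_zero` (x10b-p1-w7 g9; Lemma 1.6.3 +
  the liftability case), VERBATIM the binder at `lam k n := stubLength k n - 1` on FULL settings (`e_i = i + 1`, the level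
  `λ - 1` carrying `T/π^{λ}T`), given both decomposition hypotheses `HasLevelDecompositions` / `HasLevelDecompositionsAt`;
* `hKS` — `DVRSettingEngineKSProofs.locR_kappaR_eq_zero_iff` (x10b-p1-w8 g10; display (ks) + Prop. 1.1.9), up to
  `LinearMap.domRestrict_apply` and `coe_kappaSel` (§1 `hKS_kappaSel`).

§2 **`DVRSetting.conclusion_of_engineInputs_full`**: on a FULL setting with H.0–H.5, `S.Conclusion hy κ.one` from the
levelwise decompositions and the FIVE remaining inputs `hlam` (at `lam := stubLength - 1`), `h159`, `hsmall`, `hchebI`,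
`hchebII` (abstract eigen-counts `ρp ρm`), and `κ_1 ≠ 0`.

§3 **`thm161_of_engineInputs_full`**: `thm161_dvrKolyvaginBound` ITSELF from ONE hypothesis — on every full,
tame-pinned setting with H.0–H.5, `𝓛_s ⊂ 𝓛` and `κ_1 ≠ 0`, the levelwise structure and eigen-counts with the five inputs
(w8 g10's `thm161_of_full_tame` ∘ §2): the residual debt of the print leaf G87 as one binder.

THEOREMS ONLY; no definition, no named fact, no instance, no `sorry`.  `thm161_dvrKolyvaginBound` is NOT proved here
(five inputs and the typed levelwise structure remain hypotheses); BSD is not proved by any of this.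
-/

set_option autoImplicit false

noncomputable section

open Function NumberField IsDedekindDomain Field
open scoped NumberField ContRepresentation Classical

namespace Literature.NumberTheory.GaloisCohomology.Howard2004

open Literature.NumberTheory.GaloisRepresentations
open Literature.NumberTheory.GaloisRepresentations.DiscreteGaloisModule

namespace DVRSetting

variable {p : ℕ} [Fact p.Prime] {K : Type} [Field K] [NumberField K]
  {R : Type} [CommRing R] [IsDomain R] [IsDiscreteValuationRing R] [Algebra ℤ_[p] R]
  {N : ℕ → Type} [∀ k, AddCommGroup (N k)] [∀ k, TopologicalSpace (N k)]
  [∀ k, DiscreteTopology (N k)] [∀ k, Module R (N k)]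
  {Rk : ℕ → Type} [∀ k, CommRing (Rk k)] [∀ k, IsLocalRing (Rk k)] [∀ k, TopologicalSpace (Rk k)]
  [∀ k, DiscreteTopology (Rk k)] [∀ k, Algebra ℤ_[p] (Rk k)] [∀ k, Algebra R (Rk k)]
  [∀ k, Module (Rk k) (N k)] [∀ k, IsScalarTower R (Rk k) (N k)]
  {Nbar : Type} [AddCommGroup Nbar] [TopologicalSpace Nbar] [DiscreteTopology Nbar]
  [∀ k, Module (Rk k) Nbar]
  {Nq : ℕ → Finset (HeightOneSpectrum (𝓞 K)) → Type} [∀ k n, AddCommGroup (Nq k n)]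
  [∀ k n, TopologicalSpace (Nq k n)] [∀ k n, DiscreteTopology (Nq k n)]
  [∀ k n, Module (Rk k) (Nq k n)] [∀ k n, Module R (Nq k n)]
  [∀ k n, IsScalarTower R (Rk k) (Nq k n)]

/-! ## §1 `hKS` in the engine's binder shape -/

/-- **The engine binder `hKS`** (`loc_ℓ(κ^{(k)}_n) = 0 ↔ loc_ℓ(κ^{(k)}_{nℓ}) = 0` for `n ∈ 𝓝(𝓛^{(2k-1)})`, `ℓ ∈ 𝓛^{(2k-1)}`,
`ℓ ∤ n`) for `loc k n ℓ := (locR k ℓ).domRestrict (selmerModuleAt k n)` and `κ := kappaSel`: w8 g10's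
`locR_kappaR_eq_zero_iff` (display (ks): `loc_ℓ` of `κ_{nℓ}` is `φ^{fs}_ℓ(loc_ℓ κ_n) ⊗ σ_ℓ` with `φ^{fs}_ℓ` an
isomorphism, Prop. 1.1.9) read through `domRestrict_apply` / `coe_kappaSel`.
[cite: Howard2004HeegnerKolyvagin, Lemma 1.6.4 proof (arXiv p. 12 L8–9, L23–25) with Def. 1.2.3 and Prop. 1.1.9] -/
theorem hKS_kappaSel (S : DVRSetting p K R N Rk Nbar Nq) (hy : S.SatisfiesH) (κ : S.KolyvaginSystem)
    (pins : ∀ v : HeightOneSpectrum (𝓞 K), TamePin v) :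
    letI : ∀ k, Module R (galoisCohomology (S.T.ρ k) 1) := fun k => galoisCohomology.moduleH1 (S.T.ρ k) (S.T.hlin k)
    letI : ∀ (k : ℕ) (v : Place K), Module R (galoisCohomology ((S.T.ρ k).toLocal v) 1) :=
      fun k v => galoisCohomology.moduleH1 ((S.T.ρ k).toLocal v) ((S.T.hlin k).restrictField (Place.Completion v))
    ∀ (k : ℕ) (n : Finset (HeightOneSpectrum (𝓞 K))) (ℓ : HeightOneSpectrum (𝓞 K)), ↑n ⊆ S.enginePrimes k →
      ℓ ∈ S.enginePrimes k → ℓ ∉ n →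
        ((S.locR k (Sum.inr ℓ)).domRestrict (S.selmerModuleAt hy k n) (S.kappaSel hy κ pins k n) = 0 ↔
          (S.locR k (Sum.inr ℓ)).domRestrict (S.selmerModuleAt hy k (insert ℓ n))
            (S.kappaSel hy κ pins k (insert ℓ n)) = 0) := by
  letI : ∀ k, Module R (galoisCohomology (S.T.ρ k) 1) := fun k => galoisCohomology.moduleH1 (S.T.ρ k) (S.T.hlin k)
  letI : ∀ (k : ℕ) (v : Place K), Module R (galoisCohomology ((S.T.ρ k).toLocal v) 1) :=
    fun k v => galoisCohomology.moduleH1 ((S.T.ρ k).toLocal v) ((S.T.hlin k).restrictField (Place.Completion v))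
  intro k n ℓ hn hℓ hℓn
  rw [LinearMap.domRestrict_apply, LinearMap.domRestrict_apply, coe_kappaSel, coe_kappaSel]
  exact S.locR_kappaR_eq_zero_iff hy κ pins k hn hℓ hℓn

/-! ## §2 Thm. 1.6.1's conclusion on a FULL setting from the five remaining inputs -/

/-- **Howard's Thm. 1.6.1 — `S.Conclusion hy κ.one` — on a FULL `DVRSetting` (`e_i = i + 1`) with H.0–H.5 and
`κ_1 ≠ 0`, from the levelwise structure (`HasLevelDecompositions`, `HasLevelDecompositionsAt`: Thm. 1.4.2 / Prop. 1.4.1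
as applied) and the FIVE remaining engine inputs** `hlam` (the liftability bookkeeping «`λ < k` and `Stub^{(λ)}(n) = 0`»,
read at the level `λ - 1` carrying `T/π^λ T`), `h159` (Prop. 1.5.9), `hsmall` («`ρ(n) ≤ 1 ⇒ Stub = H`»), `hchebI` /
`hchebII` (Lemma 1.6.2 + Lemma 1.5.3) for eigen-counts `ρp ρm`: `conclusion_of_engineInputs` with `hlift :=` w7 g9's
`kappaSel_mem_stub_of_redSel_eq_zero` and `hKS :=` §1.  `thm161_dvrKolyvaginBound` is NOT proved here.
[cite: Howard2004HeegnerKolyvagin, Thm. 1.6.1 and Lemma 1.6.4 (arXiv Thm. 2.6.1, p. 11 L23–44; Lemma 2.6.4, p. 11 L82 – p. 12 L33)] -/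
theorem conclusion_of_engineInputs_full (S : DVRSetting p K R N Rk Nbar Nq) (hy : S.SatisfiesH)
    (κ : S.KolyvaginSystem) (pins : ∀ v : HeightOneSpectrum (𝓞 K), TamePin v) (hdec : S.HasLevelDecompositions hy)
    (hdecAt : S.HasLevelDecompositionsAt hy) (hfull : ∀ i, S.e i = i + 1)
    (ρp ρm : ℕ → Finset (HeightOneSpectrum (𝓞 K)) → ℕ) :
    letI : ∀ k, Module R (galoisCohomology (S.T.ρ k) 1) := fun k => galoisCohomology.moduleH1 (S.T.ρ k) (S.T.hlin k)
    letI : ∀ (k : ℕ) (v : Place K), Module R (galoisCohomology ((S.T.ρ k).toLocal v) 1) :=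
      fun k v => galoisCohomology.moduleH1 ((S.T.ρ k).toLocal v) ((S.T.hlin k).restrictField (Place.Completion v))
    (∀ k n, ↑n ⊆ S.enginePrimes k → S.stub hy hdec k n ≠ ⊥ →
        S.stub hy hdec k n = ⊤ ∨
          (S.stubLength hy hdec k n - 1 < k ∧ S.stub hy hdec (S.stubLength hy hdec k n - 1) n = ⊥)) →
    (∀ k n (ℓ : HeightOneSpectrum (𝓞 K)), ↑n ⊆ S.enginePrimes k → ℓ ∈ S.enginePrimes k → ℓ ∉ n →
        S.stub hy hdec k n ≤ LinearMap.ker ((S.locR k (Sum.inr ℓ)).domRestrict (S.selmerModuleAt hy k n)) →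
          S.stub hy hdec k (insert ℓ n) ≤
            LinearMap.ker ((S.locR k (Sum.inr ℓ)).domRestrict (S.selmerModuleAt hy k (insert ℓ n)))) →
    (∀ k n, ↑n ⊆ S.enginePrimes k → ρp k n + ρm k n ≤ 1 → S.stub hy hdec k n = ⊤) →
    (∀ k n, ↑n ⊆ S.enginePrimes k → 0 < ρp k n → 0 < ρm k n → ∀ d : ↥(S.selmerModuleAt hy k n), d ≠ 0 →
        S.π • d = 0 → ∃ ℓ ∈ S.enginePrimes k, ℓ ∉ n ∧
          (S.locR k (Sum.inr ℓ)).domRestrict (S.selmerModuleAt hy k n) d ≠ 0 ∧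
            ρp k (insert ℓ n) + 1 = ρp k n ∧ ρm k (insert ℓ n) + 1 = ρm k n) →
    (∀ k n, ↑n ⊆ S.enginePrimes k → (ρm k n = 0 ∧ 2 ≤ ρp k n) ∨ (ρp k n = 0 ∧ 2 ≤ ρm k n) →
        ∀ d : ↥(S.selmerModuleAt hy k n), d ≠ 0 → S.π • d = 0 →
          ∃ ℓ ∈ S.enginePrimes k, ℓ ∉ n ∧ (S.locR k (Sum.inr ℓ)).domRestrict (S.selmerModuleAt hy k n) d ≠ 0 ∧
            0 < ρp k (insert ℓ n) ∧ 0 < ρm k (insert ℓ n) ∧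
              ρp k (insert ℓ n) + ρm k (insert ℓ n) = ρp k n + ρm k n) →
    κ.one ≠ 0 → S.Conclusion hy κ.one := by
  letI : ∀ k, Module R (galoisCohomology (S.T.ρ k) 1) := fun k => galoisCohomology.moduleH1 (S.T.ρ k) (S.T.hlin k)
  letI : ∀ (k : ℕ) (v : Place K), Module R (galoisCohomology ((S.T.ρ k).toLocal v) 1) :=
    fun k v => galoisCohomology.moduleH1 ((S.T.ρ k).toLocal v) ((S.T.hlin k).restrictField (Place.Completion v))
  intro hlam h159 hsmall hchebI hchebII hone
  exact S.conclusion_of_engineInputs hy κ pins hdec ρp ρm (fun k n => S.stubLength hy hdec k n - 1) hlam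
    (S.kappaSel_mem_stub_of_redSel_eq_zero hy hdec hdecAt hfull κ pins) (S.hKS_kappaSel hy κ pins) h159 hsmall
    hchebI hchebII hone

/-! ## §3 `thm161_dvrKolyvaginBound` from the five remaining inputs on full, tame-pinned settings -/

/-- **Howard's Thm. 1.6.1 as typed (`thm161_dvrKolyvaginBound`) from ONE hypothesis: on every FULL, TAME-PINNED
`DVRSetting` with H.0–H.5, `𝓛_s ⊂ 𝓛` for `s ≫ 0` and `κ_1 ≠ 0`, the levelwise structure (`HasLevelDecompositions`,
`HasLevelDecompositionsAt` — Thm. 1.4.2 / Prop. 1.4.1 as applied) together with eigen-counts `ρp ρm` satisfying the five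
remaining engine inputs `hlam`, `h159`, `hsmall`, `hchebI`, `hchebII`** (the binder list of `thm161_of_full_tame`
verbatim, the conclusion replaced by this existential).  Proof: `thm161_of_full_tame` (TAME-WLOG + the `π`-adic
refinement + the cofinal transfer) then §2.  This names the residual debt of the print leaf G87 after the engine, the
data layer, `hred`, `hlift`, `hKS` and the refinement programme; `thm161_dvrKolyvaginBound` is NOT proved here.
[cite: Howard2004HeegnerKolyvagin, Thm. 1.6.1 and its proof (arXiv Thm. 2.6.1, p. 11 L23–47; Lemma 2.6.4, p. 11 L82 – p. 12 L55)] -/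
theorem thm161_of_engineInputs_full
    (h : ∀ (p : ℕ) [Fact p.Prime] (K : Type) [Field K] [NumberField K]
      (R : Type) [CommRing R] [IsDomain R] [IsDiscreteValuationRing R] [Algebra ℤ_[p] R]
      (N : ℕ → Type) [∀ k, AddCommGroup (N k)] [∀ k, TopologicalSpace (N k)]
      [∀ k, DiscreteTopology (N k)] [∀ k, Module R (N k)]
      (Rk : ℕ → Type) [∀ k, CommRing (Rk k)] [∀ k, IsLocalRing (Rk k)] [∀ k, TopologicalSpace (Rk k)]
      [∀ k, DiscreteTopology (Rk k)] [∀ k, Algebra ℤ_[p] (Rk k)] [∀ k, Algebra R (Rk k)]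
      [∀ k, Module (Rk k) (N k)] [∀ k, IsScalarTower R (Rk k) (N k)]
      (Nbar : Type) [AddCommGroup Nbar] [TopologicalSpace Nbar] [DiscreteTopology Nbar]
      [∀ k, Module (Rk k) Nbar]
      (Nq : ℕ → Finset (HeightOneSpectrum (𝓞 K)) → Type) [∀ k n, AddCommGroup (Nq k n)]
      [∀ k n, TopologicalSpace (Nq k n)] [∀ k n, DiscreteTopology (Nq k n)]
      [∀ k n, Module (Rk k) (Nq k n)] [∀ k n, Module R (Nq k n)]
      [∀ k n, IsScalarTower R (Rk k) (Nq k n)] [∀ k n, Finite (Nq k n)]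
      (S : DVRSetting p K R N Rk Nbar Nq) (κ : S.KolyvaginSystem) (hy : S.SatisfiesH)
      (pins : ∀ v : HeightOneSpectrum (𝓞 K), TamePin v)
      (hP : ∀ k n v, n ∈ levels S.L ∧ v ∈ n → TameHyp (S.LD k).ρq n v),
      (∀ i, S.e i = i + 1) →
      (∀ k, (S.LD k).fs = tameSlotOn pins (S.LD k).ρq (fun n v => n ∈ levels S.L ∧ v ∈ n) (hP k)) →
      S.LargePrimes → κ.one ≠ 0 →
      letI : ∀ k, Module R (galoisCohomology (S.T.ρ k) 1) :=
        fun k => galoisCohomology.moduleH1 (S.T.ρ k) (S.T.hlin k)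
      letI : ∀ (k : ℕ) (v : Place K), Module R (galoisCohomology ((S.T.ρ k).toLocal v) 1) :=
        fun k v => galoisCohomology.moduleH1 ((S.T.ρ k).toLocal v) ((S.T.hlin k).restrictField (Place.Completion v))
      ∃ (hdec : S.HasLevelDecompositions hy) (_ : S.HasLevelDecompositionsAt hy)
        (ρp ρm : ℕ → Finset (HeightOneSpectrum (𝓞 K)) → ℕ),
        (∀ k n, ↑n ⊆ S.enginePrimes k → S.stub hy hdec k n ≠ ⊥ →
          S.stub hy hdec k n = ⊤ ∨
            (S.stubLength hy hdec k n - 1 < k ∧ S.stub hy hdec (S.stubLength hy hdec k n - 1) n = ⊥)) ∧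
        (∀ k n (ℓ : HeightOneSpectrum (𝓞 K)), ↑n ⊆ S.enginePrimes k → ℓ ∈ S.enginePrimes k → ℓ ∉ n →
          S.stub hy hdec k n ≤ LinearMap.ker ((S.locR k (Sum.inr ℓ)).domRestrict (S.selmerModuleAt hy k n)) →
            S.stub hy hdec k (insert ℓ n) ≤
              LinearMap.ker ((S.locR k (Sum.inr ℓ)).domRestrict (S.selmerModuleAt hy k (insert ℓ n)))) ∧
        (∀ k n, ↑n ⊆ S.enginePrimes k → ρp k n + ρm k n ≤ 1 → S.stub hy hdec k n = ⊤) ∧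
        (∀ k n, ↑n ⊆ S.enginePrimes k → 0 < ρp k n → 0 < ρm k n → ∀ d : ↥(S.selmerModuleAt hy k n), d ≠ 0 →
          S.π • d = 0 → ∃ ℓ ∈ S.enginePrimes k, ℓ ∉ n ∧
            (S.locR k (Sum.inr ℓ)).domRestrict (S.selmerModuleAt hy k n) d ≠ 0 ∧
              ρp k (insert ℓ n) + 1 = ρp k n ∧ ρm k (insert ℓ n) + 1 = ρm k n) ∧
        (∀ k n, ↑n ⊆ S.enginePrimes k → (ρm k n = 0 ∧ 2 ≤ ρp k n) ∨ (ρp k n = 0 ∧ 2 ≤ ρm k n) →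
          ∀ d : ↥(S.selmerModuleAt hy k n), d ≠ 0 → S.π • d = 0 →
            ∃ ℓ ∈ S.enginePrimes k, ℓ ∉ n ∧ (S.locR k (Sum.inr ℓ)).domRestrict (S.selmerModuleAt hy k n) d ≠ 0 ∧
              0 < ρp k (insert ℓ n) ∧ 0 < ρm k (insert ℓ n) ∧
                ρp k (insert ℓ n) + ρm k (insert ℓ n) = ρp k n + ρm k n)) :
    thm161_dvrKolyvaginBound := by
  refine thm161_of_full_tame ?_
  intro p _ K _ _ R _ _ _ _ N _ _ _ _ Rk _ _ _ _ _ _ _ _ Nbar _ _ _ _ Nq _ _ _ _ _ _ _ S κ hy pins hP hfull htame hL hone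
  obtain ⟨hdec, hdecAt, ρp, ρm, hlam, h159, hsmall, hchebI, hchebII⟩ :=
    h p K R N Rk Nbar Nq S κ hy pins hP hfull htame hL hone
  exact S.conclusion_of_engineInputs_full hy κ pins hdec hdecAt hfull ρp ρm hlam h159 hsmall hchebI hchebII hone

end DVRSetting

end Literature.NumberTheory.GaloisCohomology.Howard2004

end
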